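import Summits.ResolutionOfSingularities.ResolutionOfSingularities.Theorems.UniversalCellsLocalToGlobalDimensionSlices
import Summits.ResolutionOfSingularities.ResolutionOfSingularities.Theorems.UniversalCellsLocalToGlobalLocalRegLeificationAtOfSandwichedStrongDimLe
import Summits.ResolutionOfSingularities.ResolutionOfSingularities.Theorems.UniversalCellsLocalToGlobalSandwichedStrongDimLeThree
import Literature.AlgebraicGeometry.Resolution.ProperModelsRegLeification
import Literature.AlgebraicGeometry.Resolution.ProperModelsPatchingGluing
import Literature.AlgebraicGeometry.Resolution.ResolutionOfSingularitiesProofs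
import Literature.AlgebraicGeometry.Morphisms.NagataCompactificationProofs
import HarnessLib

/-!
# ResolutionOfSingularities / UniversalCells — crux `LocalToGlobal`, line `birth` v3 (cycle 2):
# the atom, child 1, and the crux from Cossart–Piltant in dimension `≤ 3` and STRONG resolution of
# sandwiched 4-folds over the prime field

Crux `stmt-ResolutionOfSingularities-15232`, decl `UniversalCells.LocalToGlobal`. Cycle 1 of the
line pinned the crux's first open slice (child 1 `OpenPatchingDimLeFour` of the dimension split) on
ONE atom — two-model patching of proper models of function fields of transcendence degree `4` over
`𝔽_p` (`openPatchingDimLeFour_of_twoModelPatching_primeField_trdeg_four`,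
`UniversalCellsLocalToGlobalDimensionSlices.lean`). This file records the first line on the shelf
FOR THAT ATOM: reading the tree's chain `SAND⁺ ⇒ LocalRegLeification ⇒ RegLeification ⇒
TwoModelPatching` (`LocalRegLeificationOfSandwiched.lean`, `ProperModelsRegLeification.lean`,
`ProperModelsPatchingGluing.lean`) one function field at a time — every strong sandwiched
resolution it needs is of `V → Reg Y` for a proper model `Y` of the SAME `K`, of dimension
`trdeg_k K` — and threading the dimension through the two landed stubs of wave 2
(`stub_localRegLeificationAt_of_sandwichedStrong_dimLe`,
`stub_sandwichedStrong_dimLe_three_of_cossartPiltant2019General`):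

* `twoModelPatching_trdegLe_of_sandwichedStrong_dimLe` — for any field `k` and `n : ℕ`: STRONG
  (iso over `Reg V`) resolution of integral `V` proper and birational over regular integral
  separated finite-type `k`-schemes `U` of dimension `≤ n` gives Piltant's two-model patching for
  proper models of every `K/k` of transcendence degree `≤ n` (local RegLe-ification per `φ`, then
  Nagata — a theorem, `NagataCompactification_holds` — then RegLe-ification twice on the join).
* `twoModelPatching_primeField_trdeg_four_of_sandwichedStrong_dimFour` — **THE ATOM from
  `CossartPiltant2019General` and `SAND⁺(𝔽_p, dim U = 4)`**: every integral `V` proper and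
  birational over a REGULAR integral separated finite-type `𝔽_p`-scheme `U` of dimension `4` has a
  resolution which is an isomorphism over `Reg V` — Cossart–Piltant 2019 Thm. 1.1 (ii) ONE
  DIMENSION UP, sandwiched case, prime field. One direction only: the atom is a weak statement
  (implied by the summit), `SAND⁺` is strong.
* `openPatchingDimLeFour_of_sandwichedStrong_primeField_dimFour`,
  `localToGlobal_of_sandwichedStrong_primeField_dimFour_of_dimGeFive` — hence child 1, and the
  crux modulo its parked dimension-`≥ 5` remainder, from `CossartPiltant2019General` and
  `SAND⁺(𝔽_p, dim U = 4)` alone (`CossartPiltant2019General` also gives the weak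
  `CossartPiltant2019`, `CossartPiltant2019General.cossartPiltant2019'`). CONDITIONAL results.

## References

* O. Zariski, Ann. of Math. 45 (1944), Fundamental Theorem p. 539. [Zariski1944]
* O. Piltant, RACSAM 107 (2013) 91–121, Prop. 5.1 (proof, Steps 2–5) and p. 2. [Piltant2013]
* V. Cossart, O. Piltant, J. Algebra 529 (2019), Thm. 1.1 (ii). [CossartPiltant2019]
-/

-- `Summit.<Summit>.<Sub>.Theorems` with `Sub = Summit` (single-conjunct summit, D-0017)
set_option linter.dupNamespace false

noncomputable section

open CategoryTheory AlgebraicGeometry TopologicalSpace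
open Literature.AlgebraicGeometry.Resolution
open Literature.AlgebraicGeometry.Morphisms (NagataCompactification_holds)
open Summit.ResolutionOfSingularities.ResolutionOfSingularities.Theses.UniversalCells (LocalToGlobal)

namespace Summit.ResolutionOfSingularities.ResolutionOfSingularities.Theorems

/-! ## Per-function-field RegLe-ification and two-model patching from SAND⁺ below a dimension bound -/

/-- **RegLe-ification of one morphism of proper models from its local RegLe-ification** (per
`(k, K, φ)`): Nagata compactification — the tree theorem `NagataCompactification_holds`, used
through `SandwichedGluing.extension_of_nagata` — extends the local datum `N → O` to a morphism of
proper models `P' → M` cartesian over `O`, and both `RegLe` clauses follow by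
`ProperModel.Hom.regLe_of_isPullback`. [cite: Piltant2013, proof of Prop. 5.1, Step 5] -/
theorem regLeificationAt_of_localAt {k K : Type} [Field k] [Field K] [Algebra k K]
    (M Y : ProperModel k K) (φ : M.Hom Y)
    (hloc : ∃ (O : M.X.Opens) (N : Scheme.{0}) (ρ : N ⟶ (O : Scheme.{0})),
      IsIntegral N ∧ IsProper ρ ∧ IsBirational ρ ∧
      (∀ m : M.X, IsRegularLocalRing (M.X.presheaf.stalk m) → m ∈ O) ∧
      (∀ m : M.X, IsRegularLocalRing (Y.X.presheaf.stalk (φ.f m)) → m ∈ O) ∧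
      (∀ n : N, IsRegularLocalRing (M.X.presheaf.stalk (ρ n).1) →
        IsRegularLocalRing (N.presheaf.stalk n)) ∧
      (∀ n : N, IsRegularLocalRing (Y.X.presheaf.stalk (φ.f (ρ n).1)) →
        IsRegularLocalRing (N.presheaf.stalk n))) :
    ∃ (M' : ProperModel k K) (ψ : M'.Hom M), ψ.RegLe ∧ (ψ.comp φ).RegLe := by
  obtain ⟨O, N, ρ, hN, hρ, hbir, hO₁, hO₂, hN₁, hN₂⟩ := hloc
  haveI := hN
  haveI := hρ
  obtain ⟨P', ψ, i, hi, hsq⟩ :=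
    SandwichedGluing.extension_of_nagata NagataCompactification_holds k K M O N ρ hbir
  haveI := hi
  exact ⟨P', ψ, ProperModel.Hom.regLe_of_isPullback φ O ρ hO₁ hO₂ hN₁ hN₂ ψ i hsq⟩

/-- **Two-model patching in transcendence degree `≤ n` over `k` from STRONG resolution of
sandwiched `k`-schemes over regular bases of dimension `≤ n`** (any field `k`, any `n : ℕ`): local
RegLe-ification of every `φ : M → Y` by `stub_localRegLeificationAt_of_sandwichedStrong_dimLe`
(the strong resolution is used for `φ⁻¹(Reg Y) → Reg Y` only, `dim Reg Y ≤ trdeg_k K ≤ n`),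
RegLe-ification by Nagata (`regLeificationAt_of_localAt`), and RegLe-ification twice on the join
`M₁ ⋈ M₂` (the argument of `SandwichedGluing.twoModelPatching_of_regLeification`).
[cite: Piltant2013, Prop. 5.1 (proof, Steps 2-5)] -/
theorem twoModelPatching_trdegLe_of_sandwichedStrong_dimLe (k : Type) [Field k] (n : ℕ)
    (hS : ∀ (U V : Scheme.{0}) (f : U ⟶ Spec (.of k)) (η : V ⟶ U), IsSeparated f →
      LocallyOfFiniteType f → QuasiCompact f → IsIntegral U → Scheme.IsRegular U → IsIntegral V →
      IsProper η → IsBirational η → topologicalKrullDim U ≤ n →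
        ∃ (Y : Scheme.{0}) (π : Y ⟶ V), IsResolution π ∧
          ∃ W : V.Opens, (W : Set V) = Scheme.regularLocus V ∧ IsIso (π ∣_ W))
    (K : Type) [Field K] [Algebra k K] [Algebra.EssFiniteType k K] (hK : Algebra.trdeg k K ≤ n)
    (M₁ M₂ : ProperModel k K) :
    ∃ (N : ProperModel k K) (φ₁ : N.Hom M₁) (φ₂ : N.Hom M₂), φ₁.RegLe ∧ φ₂.RegLe := by
  have hRL : ∀ (M Y : ProperModel k K) (φ : M.Hom Y),
      ∃ (M' : ProperModel k K) (ψ : M'.Hom M), ψ.RegLe ∧ (ψ.comp φ).RegLe :=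
    fun M Y φ => regLeificationAt_of_localAt M Y φ
      (stub_localRegLeificationAt_of_sandwichedStrong_dimLe k n hS K hK M Y φ)
  obtain ⟨M', ψ, hψ, hψ₂⟩ := hRL (ProperModel.join M₁ M₂) M₂ (ProperModel.joinSnd M₁ M₂)
  obtain ⟨M'', ψ', hψ', hψ'₁⟩ := hRL M' M₁ (ψ.comp (ProperModel.joinFst M₁ M₂))
  exact ⟨M'', ψ'.comp (ψ.comp (ProperModel.joinFst M₁ M₂)),
    ψ'.comp (ψ.comp (ProperModel.joinSnd M₁ M₂)), hψ'₁, hψ'.comp hψ₂⟩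

/-! ## The atom, child 1 and the crux from `CossartPiltant2019General` and SAND⁺(𝔽_p, dim 4) -/

/-- A topological Krull dimension (an element of `WithBot ℕ∞`) that is `≤ 4` but not `≤ 3`
equals `4`. [folklore] -/
theorem topologicalKrullDim_eq_four_of_le_four_of_not_le_three {x : WithBot ℕ∞}
    (h4 : x ≤ (4 : ℕ)) (h3 : ¬ x ≤ (3 : ℕ)) : x = (4 : ℕ) := by
  induction x using WithBot.recBotCoe with
  | bot => exact absurd bot_le h3
  | coe y =>
    have h4' : y ≤ (4 : ℕ) := by
      rw [show ((4 : ℕ) : WithBot ℕ∞) = (((4 : ℕ) : ℕ∞) : WithBot ℕ∞) from rfl] at h4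
      exact WithBot.coe_le_coe.mp h4
    have h3' : ¬ y ≤ (3 : ℕ) := fun h =>
      h3 (by
        rw [show ((3 : ℕ) : WithBot ℕ∞) = (((3 : ℕ) : ℕ∞) : WithBot ℕ∞) from rfl]
        exact WithBot.coe_le_coe.mpr h)
    have hy : y = (4 : ℕ) := by
      induction y using ENat.recTopCoe with
      | top => exact absurd h4' (by simp)
      | coe m =>
        have h4m : m ≤ 4 := by exact_mod_cast h4'
        have h3m : ¬ m ≤ 3 := fun h => h3' (by exact_mod_cast h)
        have hm : m = 4 := by omega
        subst hm
        rfl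
    subst hy
    rfl

/-- **SAND⁺ over `k` in dimension `≤ 4` from `CossartPiltant2019General` (dimension `≤ 3`, via
`stub_sandwichedStrong_dimLe_three_of_cossartPiltant2019General`) and the dimension-`4` statement.**
[cite: CossartPiltant2019, Thm. 1.1 (ii)] -/
theorem sandwichedStrong_dimLe_four_of_dimFour (hG : CossartPiltant2019General.{0}) (k : Type)
    [Field k]
    (hS4 : ∀ (U V : Scheme.{0}) (f : U ⟶ Spec (.of k)) (η : V ⟶ U), IsSeparated f →
      LocallyOfFiniteType f → QuasiCompact f → IsIntegral U → Scheme.IsRegular U → IsIntegral V →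
      IsProper η → IsBirational η → topologicalKrullDim U = 4 →
        ∃ (Y : Scheme.{0}) (π : Y ⟶ V), IsResolution π ∧
          ∃ W : V.Opens, (W : Set V) = Scheme.regularLocus V ∧ IsIso (π ∣_ W))
    (U V : Scheme.{0}) (f : U ⟶ Spec (.of k)) (η : V ⟶ U) (hs : IsSeparated f)
    (hl : LocallyOfFiniteType f) (hq : QuasiCompact f) (hU : IsIntegral U)
    (hreg : Scheme.IsRegular U) (hV : IsIntegral V) (hη : IsProper η) (hb : IsBirational η)
    (hdim : topologicalKrullDim U ≤ (4 : ℕ)) :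
    ∃ (Y : Scheme.{0}) (π : Y ⟶ V), IsResolution π ∧
      ∃ W : V.Opens, (W : Set V) = Scheme.regularLocus V ∧ IsIso (π ∣_ W) := by
  by_cases h3 : topologicalKrullDim U ≤ 3
  · haveI := hs; haveI := hl; haveI := hq; haveI := hU; haveI := hV; haveI := hη
    exact stub_sandwichedStrong_dimLe_three_of_cossartPiltant2019General hG k U V f η hb h3
  · have h3c : ¬ topologicalKrullDim U ≤ (3 : ℕ) := fun h => h3 (by exact_mod_cast h)
    have h4 : topologicalKrullDim U = 4 := by
      exact_mod_cast topologicalKrullDim_eq_four_of_le_four_of_not_le_three hdim h3c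
    exact hS4 U V f η hs hl hq hU hreg hV hη hb h4

/-- **THE ATOM from Cossart–Piltant 2019 in dimension `≤ 3` and STRONG resolution of sandwiched
4-folds over the prime field.** Two-model patching of proper models of function fields of
transcendence degree `4` over `𝔽_p` (the registered atom `stub_twoModelPatching_primeField_trdeg_four`
of line `birth` v3, statement verbatim) follows from `CossartPiltant2019General` (printed) and
`SAND⁺(𝔽_p, dim U = 4)`: every integral `V` proper and birational over a regular integral
separated finite-type `𝔽_p`-scheme `U` of dimension `4` has a resolution which is an isomorphism
over `Reg V` — Cossart–Piltant's Theorem 1.1 (ii) one dimension up, sandwiched case, at the prime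
field. The converse is not claimed (weak vs. strong). A CONDITIONAL result.
[cite: CossartPiltant2019, Thm. 1.1 (ii); Piltant2013, Prop. 5.1 and p. 2] -/
theorem twoModelPatching_primeField_trdeg_four_of_sandwichedStrong_dimFour
    (hG : CossartPiltant2019General.{0})
    (hS4 : ∀ (p : ℕ) [Fact p.Prime] (U V : Scheme.{0}) (f : U ⟶ Spec (.of (ZMod p)))
      (η : V ⟶ U), IsSeparated f → LocallyOfFiniteType f → QuasiCompact f → IsIntegral U →
      Scheme.IsRegular U → IsIntegral V → IsProper η → IsBirational η →
      topologicalKrullDim U = 4 →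
        ∃ (Y : Scheme.{0}) (π : Y ⟶ V), IsResolution π ∧
          ∃ W : V.Opens, (W : Set V) = Scheme.regularLocus V ∧ IsIso (π ∣_ W))
    (p : ℕ) [Fact p.Prime] (K : Type) [Field K] [Algebra (ZMod p) K]
    [Algebra.EssFiniteType (ZMod p) K] (hK : Algebra.trdeg (ZMod p) K = 4)
    (M₁ M₂ : ProperModel (ZMod p) K) :
    ∃ (N : ProperModel (ZMod p) K) (φ₁ : N.Hom M₁) (φ₂ : N.Hom M₂), φ₁.RegLe ∧ φ₂.RegLe :=
  twoModelPatching_trdegLe_of_sandwichedStrong_dimLe (ZMod p) 4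
    (fun U V f η hs hl hq hU hreg hV hη hb hdim =>
      sandwichedStrong_dimLe_four_of_dimFour hG (ZMod p) (hS4 p) U V f η hs hl hq hU hreg hV hη hb
        hdim)
    K hK.le M₁ M₂

/-- **Child 1 `OpenPatchingDimLeFour` of the dimension split from `CossartPiltant2019General` and
`SAND⁺(𝔽_p, dim U = 4)`**: the atom by
`twoModelPatching_primeField_trdeg_four_of_sandwichedStrong_dimFour`, the weak `CossartPiltant2019`
by `CossartPiltant2019General.cossartPiltant2019'`, then
`openPatchingDimLeFour_of_twoModelPatching_primeField_trdeg_four`. A CONDITIONAL result.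
[cite: CossartPiltant2019, Thm. 1.1 (ii); Piltant2013, Prop. 5.1] -/
theorem openPatchingDimLeFour_of_sandwichedStrong_primeField_dimFour
    (hG : CossartPiltant2019General.{0})
    (hS4 : ∀ (p : ℕ) [Fact p.Prime] (U V : Scheme.{0}) (f : U ⟶ Spec (.of (ZMod p)))
      (η : V ⟶ U), IsSeparated f → LocallyOfFiniteType f → QuasiCompact f → IsIntegral U →
      Scheme.IsRegular U → IsIntegral V → IsProper η → IsBirational η →
      topologicalKrullDim U = 4 →
        ∃ (Y : Scheme.{0}) (π : Y ⟶ V), IsResolution π ∧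
          ∃ W : V.Opens, (W : Set V) = Scheme.regularLocus V ∧ IsIso (π ∣_ W))
    (p : ℕ) (hp : p.Prime) (X : Scheme.{0}) (f : X ⟶ Spec (.of (ZMod p))) (hs : IsSeparated f)
    (hl : LocallyOfFiniteType f) (hq : QuasiCompact f) (hi : IsIntegral X)
    (hX : topologicalKrullDim X ≤ 4) (U V : X.Opens) (hUV : U ⊔ V = ⊤)
    (hU : ∃ (Z : Scheme.{0}) (π : Z ⟶ X), IsIntegral Z ∧ IsProper π ∧ IsBirational π ∧
      ∀ z : Z, π.base z ∈ U → IsRegularLocalRing (Z.presheaf.stalk z))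
    (hV : ∃ (Z : Scheme.{0}) (π : Z ⟶ X), IsIntegral Z ∧ IsProper π ∧ IsBirational π ∧
      ∀ z : Z, π.base z ∈ V → IsRegularLocalRing (Z.presheaf.stalk z)) :
    Scheme.HasResolution X :=
  openPatchingDimLeFour_of_twoModelPatching_primeField_trdeg_four hG.cossartPiltant2019'
    (fun p _ K _ _ _ hK M₁ M₂ =>
      twoModelPatching_primeField_trdeg_four_of_sandwichedStrong_dimFour hG hS4 p K hK M₁ M₂)
    p hp X f hs hl hq hi hX U V hUV hU hV

/-- **The crux `LocalToGlobal` from `CossartPiltant2019General`, `SAND⁺(𝔽_p, dim U = 4)` and its own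
parked dimension-`≥ 5` remainder** (line `birth` v3 closed modulo Cossart–Piltant one dimension
up, sandwiched case, prime field — and the remainder). A CONDITIONAL result: the item stays open.
[cite: CossartPiltant2019, Thm. 1.1 (ii); Piltant2013, Prop. 5.1 and p. 2; Hu2021, p. 65] -/
theorem localToGlobal_of_sandwichedStrong_primeField_dimFour_of_dimGeFive
    (hG : CossartPiltant2019General.{0})
    (hS4 : ∀ (p : ℕ) [Fact p.Prime] (U V : Scheme.{0}) (f : U ⟶ Spec (.of (ZMod p)))
      (η : V ⟶ U), IsSeparated f → LocallyOfFiniteType f → QuasiCompact f → IsIntegral U →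
      Scheme.IsRegular U → IsIntegral V → IsProper η → IsBirational η →
      topologicalKrullDim U = 4 →
        ∃ (Y : Scheme.{0}) (π : Y ⟶ V), IsResolution π ∧
          ∃ W : V.Opens, (W : Set V) = Scheme.regularLocus V ∧ IsIso (π ∣_ W))
    (hD : ∀ p : ℕ, p.Prime → (∀ (X : Scheme.{0}) (f : X ⟶ Spec (.of (ZMod p))), IsSeparated f →
      LocallyOfFiniteType f → QuasiCompact f → IsIntegral X → ∀ x : X, ∃ U : X.Opens, x ∈ U ∧
        Scheme.HasResolution (U : Scheme.{0})) →
      ∀ (X : Scheme.{0}) (f : X ⟶ Spec (.of (ZMod p))), IsSeparated f → LocallyOfFiniteType f →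
      QuasiCompact f → IsIntegral X → ¬ topologicalKrullDim X ≤ 4 → Scheme.HasResolution X) :
    LocalToGlobal :=
  localToGlobal_of_cossartPiltant2019_of_trdeg_four_of_dimGeFive hG.cossartPiltant2019'
    (fun p _ K _ _ _ hK M₁ M₂ =>
      twoModelPatching_primeField_trdeg_four_of_sandwichedStrong_dimFour hG hS4 p K hK M₁ M₂)
    hD

end Summit.ResolutionOfSingularities.ResolutionOfSingularities.Theorems

end
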